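import Literature.NumberTheory.Automorphic.ParabolicSemidirect
import Literature.NumberTheory.Automorphic.UnipotentTateDomain
import Literature.NumberTheory.Automorphic.SmoothedAutomorphicForms
import Mathlib.MeasureTheory.Constructions.Pi
import HarnessLib

/-!
# The Haar measure of `N_n(𝔸_K)` in coordinates: `du = ⊗_{i<j} du_{ij}`

Topic `NumberTheory/Automorphic`; namespace `Literature.NumberTheory.Automorphic` (the abstract shear
lemma in the sub-namespace `Shear`). First layer of the proof of Borel–Harish-Chandra finiteness for
`GL_n` over a number field (`AdelicGroupData.exists_isAutomorphicMeasure_gl`, Borel (1963), Thm. 5.8),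
whose analytic heart is the finiteness of the Haar volume of a Siegel set; that computation runs in the
coordinates `g = m u k` of `GL_n(𝔸_K) = M(𝔸_K) N(𝔸_K) K` and needs the Haar measure of the unipotent
radical `N(𝔸_K)` of the Borel subgroup in the coordinates given by the matrix entries. Everything here
is proved (Mathlib + the tree's `ParabolicSemidirect`, `UnipotentTateDomain`):

* `Shear.measurePreserving_shear` — **triangular shears preserve product measures**: on `ι → A`
  (`A` a measurable abelian group, `μ` a σ-finite translation invariant measure, `ι` finite) the map
  `x ↦ (x_i + f_i(x))_i` preserves `μ^{⊗ι}` as soon as each `f_i` is measurable and only depends on the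
  coordinates of rank `> rank i` (composite of the "level shears" `Shear.levelShear`, each a skew
  product of translations, Mathlib `MeasurePreserving.skew_product`).
* `borelAdelic n K`, `unipotentBorelAdelic n K`, `leviBorelAdelic n K` — the adelic Borel subgroup
  `B(𝔸_K) = P_id(𝔸_K)` of the honest datum `AdelicGroupData.gl n K` (`parabolicAdelic n K id` of
  `GLnAdelicIntegrationFacts`), its unipotent radical and its Levi subgroup (`unipotentRadicalP`,
  `leviP`), the form in which `isTopSemidirect_parabolicAdelic` and `SemidirectHaar` apply.
* `unipCoordsHomeomorph n K : N(𝔸_K) ≃ₜ 𝔸_K^{(i<j)}` — the upper entries are global coordinates;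
  `unipCoords_mul` — left multiplication is a triangular shear in these coordinates
  (`unitriangular_mul_apply_of_lt` of `UnipotentTateDomain`).
* `unipotentCoordHaar n K μ_𝔸` — the image of `⊗_{i<j} μ_𝔸` (`μ_𝔸` an additive Haar measure of `𝔸_K`);
  **it is a Haar measure of `N(𝔸_K)`** (`isHaarMeasure_unipotentCoordHaar`: left invariant by the
  shear lemma, finite on compacts and positive on opens through the homeomorphism), and
  `unipotentCoordHaar_box` — **a coordinate box `{u : u_{ij} ∈ D_{ij}}` has measure `∏ μ_𝔸(D_{ij})`**.

This is the standard description of the Haar measure of a unipotent group as the Lebesgue measure of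
its coordinates (Bourbaki, *Intégration* VII §3 no. 3, Prop. 5; Godement, Sém. Bourbaki 257, §8 for
`N(𝔸)`); no Mathlib or tree statement covers it (`lean search 'unitriangular.*Haar|shear'`), tagged
folklore.

## References

* A. Borel, *Some finiteness properties of adele groups over number fields*, Publ. Math. IHÉS 16
  (1963), §5, Thm. 5.8 [Borel1963].
* N. Bourbaki, *Intégration*, Ch. VII §3 no. 3.
* R. Godement, *Domaines fondamentaux des groupes arithmétiques*, Sém. Bourbaki 257 (1962/63), §8.
-/

noncomputable section

open MeasureTheory Measure Set Function NumberField IsDedekindDomain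
open scoped ENNReal NNReal Pointwise

namespace Literature.NumberTheory.Automorphic

/-! ### Triangular shears preserve product measures -/

namespace Shear

section Defs

variable {ι : Type*} {A : Type*} [Add A] (rank : ι → ℕ) (f : ι → (ι → A) → A)

/-- The elementary shear of level `r`: the coordinates of rank `r` are translated by `f i x`,
the others are unchanged. [folklore] -/
def levelShear (r : ℕ) (x : ι → A) (i : ι) : A :=
  if rank i = r then x i + f i x else x i

/-- The composite of the level shears of levels `0, …, k - 1`. [folklore] -/
def iterShear : ℕ → (ι → A) → (ι → A)
  | 0 => id
  | k + 1 => levelShear rank f k ∘ iterShear k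

variable {rank f}

/-- After `k` steps the coordinates of rank `< k` carry their final value `x i + f i x` and the
others are untouched, provided `f i` only depends on the coordinates of rank `> rank i`.
[folklore] -/
theorem iterShear_apply (hdep : ∀ i x y, (∀ j, rank i < rank j → x j = y j) → f i x = f i y)
    (k : ℕ) (x : ι → A) (i : ι) :
    iterShear rank f k x i = if rank i < k then x i + f i x else x i := by
  induction k generalizing i with
  | zero => simp [iterShear]
  | succ k ih =>
    simp only [iterShear, comp_apply, levelShear]
    by_cases hi : rank i = k
    · rw [if_pos hi, ih, if_neg (by omega), if_pos (by omega)]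
      congr 1
      refine hdep i _ _ fun j hj => ?_
      rw [ih, if_neg (by omega)]
    · rw [if_neg hi, ih]
      by_cases hik : rank i < k
      · rw [if_pos hik, if_pos (by omega)]
      · rw [if_neg hik, if_neg (by omega)]

/-- The full shear `x ↦ (x i + f i x)_i` is the iterate beyond the largest rank. [folklore] -/
theorem iterShear_eq_shear [Fintype ι]
    (hdep : ∀ i x y, (∀ j, rank i < rank j → x j = y j) → f i x = f i y) (x : ι → A) :
    iterShear rank f (Finset.univ.sup rank + 1) x = fun i => x i + f i x := by
  funext i
  rw [iterShear_apply hdep, if_pos]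
  exact Nat.lt_succ_of_le (Finset.le_sup (Finset.mem_univ i))

end Defs

section Measure

variable {ι : Type*} [Fintype ι] {A : Type*} [AddCommGroup A] [MeasurableSpace A]
  [MeasurableAdd₂ A] (μ : Measure A) [SigmaFinite μ] [μ.IsAddRightInvariant]
  {rank : ι → ℕ} {f : ι → (ι → A) → A}

omit [Fintype ι] [AddCommGroup A] [MeasurableAdd₂ A] in
/-- Unfolding of `MeasurableEquiv.piEquivPiSubtypeProd` (forward map). [folklore] -/
theorem piEquivPiSubtypeProd_apply (p : ι → Prop) [DecidablePred p] (x : ι → A) :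
    MeasurableEquiv.piEquivPiSubtypeProd (fun _ : ι => A) p x =
      ((fun i : {i // p i} => x i), fun i : {i // ¬p i} => x i) := rfl

omit [Fintype ι] [AddCommGroup A] [MeasurableAdd₂ A] in
/-- Unfolding of `MeasurableEquiv.piEquivPiSubtypeProd` (inverse map). [folklore] -/
theorem piEquivPiSubtypeProd_symm_apply (p : ι → Prop) [DecidablePred p]
    (u : {i // p i} → A) (v : {i // ¬p i} → A) (i : ι) :
    (MeasurableEquiv.piEquivPiSubtypeProd (fun _ : ι => A) p).symm (u, v) i =
      if h : p i then u ⟨i, h⟩ else v ⟨i, h⟩ := rfl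

/-- **An elementary level shear preserves the product measure**: in the coordinates
`(rank = r) × (rank ≠ r)` it is `(u, v) ↦ (u + G v, v)`, a skew product of translations of the
product group of the rank-`r` coordinates over the identity of the others
(Mathlib `MeasurePreserving.skew_product`). [folklore] -/
theorem measurePreserving_levelShear (hf : ∀ i, Measurable (f i))
    (hdep : ∀ i x y, (∀ j, rank i < rank j → x j = y j) → f i x = f i y) (r : ℕ) :
    MeasurePreserving (levelShear rank f r) (Measure.pi fun _ : ι => μ)
      (Measure.pi fun _ : ι => μ) := by
  classical
  set e := MeasurableEquiv.piEquivPiSubtypeProd (fun _ : ι => A) (fun i => rank i = r) with he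
  have hpe : MeasurePreserving e (Measure.pi fun _ : ι => μ)
      ((Measure.pi fun _ : {i // rank i = r} => μ).prod
        (Measure.pi fun _ : {i // ¬rank i = r} => μ)) :=
    measurePreserving_piEquivPiSubtypeProd (fun _ : ι => μ) (fun i => rank i = r)
  set G : ({i // ¬rank i = r} → A) → ({i // rank i = r} → A) :=
    fun v i => f i (e.symm (0, v)) with hG
  have hGm : Measurable G := by
    refine measurable_pi_lambda _ fun i => (hf i).comp ?_
    exact e.symm.measurable.comp (measurable_const.prodMk measurable_id)
  have hconj : ∀ p : ({i // rank i = r} → A) × ({i // ¬rank i = r} → A),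
      e (levelShear rank f r (e.symm p)) = (p.1 + G p.2, p.2) := by
    rintro ⟨u, v⟩
    have hfe : ∀ i : ι, rank i = r → f i (e.symm (u, v)) = f i (e.symm (0, v)) := by
      intro i hi
      refine hdep i _ _ fun j hj => ?_
      have hjr : ¬rank j = r := by omega
      rw [he, piEquivPiSubtypeProd_symm_apply, piEquivPiSubtypeProd_symm_apply, dif_neg hjr,
        dif_neg hjr]
    refine Prod.ext ?_ ?_
    · funext i
      rw [he, piEquivPiSubtypeProd_apply]
      dsimp only
      rw [levelShear, if_pos i.2, Pi.add_apply, ← he, hfe i i.2, he,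
        piEquivPiSubtypeProd_symm_apply, dif_pos i.2]
    · funext i
      rw [he, piEquivPiSubtypeProd_apply]
      dsimp only
      rw [levelShear, if_neg i.2, piEquivPiSubtypeProd_symm_apply, dif_neg i.2]
  have hskew : MeasurePreserving
      (fun q : ({i // ¬rank i = r} → A) × ({i // rank i = r} → A) => (q.1, q.2 + G q.1))
      ((Measure.pi fun _ : {i // ¬rank i = r} => μ).prod (Measure.pi fun _ : {i // rank i = r} => μ))
      ((Measure.pi fun _ : {i // ¬rank i = r} => μ).prod (Measure.pi fun _ : {i // rank i = r} => μ)) := by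
    refine (MeasurePreserving.id _).skew_product (g := fun v u => u + G v) ?_ ?_
    · exact measurable_snd.add (hGm.comp measurable_fst)
    · exact Filter.Eventually.of_forall fun v => map_add_right_eq_self _ (G v)
  have hswap : MeasurePreserving
      (fun p : ({i // rank i = r} → A) × ({i // ¬rank i = r} → A) => (p.1 + G p.2, p.2))
      ((Measure.pi fun _ : {i // rank i = r} => μ).prod (Measure.pi fun _ : {i // ¬rank i = r} => μ))
      ((Measure.pi fun _ : {i // rank i = r} => μ).prod (Measure.pi fun _ : {i // ¬rank i = r} => μ)) := by
    have h := (measurePreserving_swap.comp hskew).comp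
      (measurePreserving_swap (μ := Measure.pi fun _ : {i // rank i = r} => μ)
        (ν := Measure.pi fun _ : {i // ¬rank i = r} => μ))
    convert h using 1
    funext p
    rfl
  have heq : levelShear rank f r = e.symm ∘ (fun p => (p.1 + G p.2, p.2)) ∘ e := by
    funext x
    simp only [comp_apply]
    rw [← hconj (e x), e.symm_apply_apply, e.symm_apply_apply]
  rw [heq]
  exact hpe.symm _ |>.comp (hswap.comp hpe)

/-- **Triangular shears preserve the product measure.** If `μ` is a σ-finite translation
invariant measure on a measurable abelian group `A` and every `f i : (ι → A) → A` is measurable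
and depends only on the coordinates `x j` with `rank j > rank i`, then `x ↦ (x i + f i x)_i`
preserves `μ^{⊗ι}` (it is the composite of the level shears; Fubini). This is the mechanism
behind "the Haar measure of a unipotent group is the Lebesgue measure of its coordinates"
(Bourbaki, *Intégration* VII §3 no. 3, Prop. 5). [folklore] -/
theorem measurePreserving_shear (hf : ∀ i, Measurable (f i))
    (hdep : ∀ i x y, (∀ j, rank i < rank j → x j = y j) → f i x = f i y) :
    MeasurePreserving (fun x i => x i + f i x) (Measure.pi fun _ : ι => μ)
      (Measure.pi fun _ : ι => μ) := by
  have hiter : ∀ k, MeasurePreserving (iterShear rank f k) (Measure.pi fun _ : ι => μ)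
      (Measure.pi fun _ : ι => μ) := by
    intro k
    induction k with
    | zero => exact MeasurePreserving.id _
    | succ k ih => exact (measurePreserving_levelShear μ hf hdep k).comp ih
  have h := hiter (Finset.univ.sup rank + 1)
  have heq : iterShear rank f (Finset.univ.sup rank + 1) = fun x i => x i + f i x :=
    funext fun x => iterShear_eq_shear hdep x
  rwa [heq] at h

end Measure

end Shear

/-! ### Coordinates on the unipotent radical `N(𝔸_K)` of the adelic Borel subgroup -/

section Coordinates

variable (n : ℕ) (K : Type) [Field K] [NumberField K]

/-- The index set of the coordinates of `N_n`: pairs `(i, j)` with `i < j`. [folklore] -/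
abbrev UpperIndex : Type := {p : Fin n × Fin n // p.1 < p.2}

/-- The adelic Borel subgroup `B(𝔸_K) = P_id(𝔸_K) ≤ GL_n(𝔸_K)` (upper triangular matrices),
the transported parabolic `parabolicAdelic n K id` of `GLnAdelicIntegrationFacts`. [folklore] -/
abbrev borelAdelic : Subgroup (AdelicGroupData.gl n K).Adelic :=
  parabolicAdelic n K (id : Fin n → Fin n)

/-- The unipotent radical `N(𝔸_K) ≤ B(𝔸_K)` (as a subgroup of the Borel, the kernel of the Levi
projection; `unipotentRadicalP` of `ParabolicGL`). [folklore] -/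
abbrev unipotentBorelAdelic : Subgroup ↥(borelAdelic n K) :=
  unipotentRadicalP (AdeleRing (𝓞 K) K) (id : Fin n → Fin n)

/-- The Levi subgroup `M(𝔸_K) ≤ B(𝔸_K)` of diagonal matrices (`leviP` of `ParabolicSemidirect`).
[folklore] -/
abbrev leviBorelAdelic : Subgroup ↥(borelAdelic n K) :=
  leviP (AdeleRing (𝓞 K) K) (id : Fin n → Fin n)

variable {n K}

/-- The matrix of an element of `GL_n(𝔸_K) = (AdelicGroupData.gl n K).Adelic`. [folklore] -/
def adelicMatrix (g : (AdelicGroupData.gl n K).Adelic) : Matrix (Fin n) (Fin n) (AdeleRing (𝓞 K) K) :=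
  (g : GL (Fin n) (AdeleRing (𝓞 K) K)).val

/-- `adelicMatrix` is multiplicative. [folklore] -/
theorem adelicMatrix_mul (g h : (AdelicGroupData.gl n K).Adelic) :
    adelicMatrix (g * h) = adelicMatrix g * adelicMatrix h := rfl

/-- `adelicMatrix` is continuous. [folklore] -/
theorem continuous_adelicMatrix : Continuous (adelicMatrix (n := n) (K := K)) :=
  Units.continuous_val

/-- An element of the Borel lies in the unipotent radical iff it is upper unitriangular as a
matrix. [folklore] -/
theorem mem_unipotentBorelAdelic_iff (p : ↥(borelAdelic n K)) :
    p ∈ unipotentBorelAdelic n K ↔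
      ((p : (AdelicGroupData.gl n K).Adelic) : GL (Fin n) (AdeleRing (𝓞 K) K)) ∈
        upperUnitriangular (Fin n) (AdeleRing (𝓞 K) K) := by
  constructor
  · intro hp
    exact ⟨⟨_, p.2⟩, hp, rfl⟩
  · rintro ⟨q, hq, hqp⟩
    have : q = p := Subtype.ext hqp
    subst this
    exact hq

/-- The matrix of an element of `N(𝔸_K)`. [folklore] -/
abbrev unipMatrix (u : ↥(unipotentBorelAdelic n K)) : Matrix (Fin n) (Fin n) (AdeleRing (𝓞 K) K) :=
  adelicMatrix ((u : ↥(borelAdelic n K)) : (AdelicGroupData.gl n K).Adelic)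

/-- `unipMatrix` is multiplicative. [folklore] -/
theorem unipMatrix_mul (u v : ↥(unipotentBorelAdelic n K)) :
    unipMatrix (u * v) = unipMatrix u * unipMatrix v := rfl

/-- `unipMatrix` is continuous. [folklore] -/
theorem continuous_unipMatrix : Continuous (unipMatrix (n := n) (K := K)) :=
  continuous_adelicMatrix.comp (continuous_subtype_val.comp continuous_subtype_val)

/-- The entries `(i, j)`, `i < j`, of an element of `N(𝔸_K)`: the coordinate map
`N(𝔸_K) → 𝔸_K^{(i<j)}`. [folklore] -/
def unipCoords (u : ↥(unipotentBorelAdelic n K)) : UpperIndex n → AdeleRing (𝓞 K) K :=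
  fun p => unipMatrix u p.1.1 p.1.2

/-- Extension of a coordinate vector by zero to all pairs `(i, j)`. [folklore] -/
def extendCoords (x : UpperIndex n → AdeleRing (𝓞 K) K) (i j : Fin n) : AdeleRing (𝓞 K) K :=
  if h : i < j then x ⟨(i, j), h⟩ else 0

/-- `extendCoords x i j = x (i, j)` for `i < j`. [folklore] -/
theorem extendCoords_of_lt (x : UpperIndex n → AdeleRing (𝓞 K) K) {i j : Fin n} (h : i < j) :
    extendCoords x i j = x ⟨(i, j), h⟩ := by
  rw [extendCoords, dif_pos h]

/-- The inverse coordinate map `𝔸_K^{(i<j)} → N(𝔸_K)`: the unitriangular matrix with the given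
upper entries (`unitriangularGL` of `UnipotentAdelicCompact`). [folklore] -/
def ofUnipCoords (x : UpperIndex n → AdeleRing (𝓞 K) K) : ↥(unipotentBorelAdelic n K) :=
  ⟨⟨unitriangularGL (extendCoords x),
      upperUnitriangular_le_standardParabolicGL (unitriangularGL_mem _)⟩,
    (mem_unipotentBorelAdelic_iff _).2 (unitriangularGL_mem _)⟩

/-- The matrix of `ofUnipCoords x`. [folklore] -/
theorem coe_ofUnipCoords (x : UpperIndex n → AdeleRing (𝓞 K) K) :
    unipMatrix (ofUnipCoords x) = unitriangularOfEntries (extendCoords x) :=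
  coe_unitriangularGL _

/-- `unipCoords (ofUnipCoords x) = x`. [folklore] -/
theorem unipCoords_ofUnipCoords (x : UpperIndex n → AdeleRing (𝓞 K) K) :
    unipCoords (ofUnipCoords x) = x := by
  funext p
  obtain ⟨⟨i, j⟩, hij⟩ := p
  show unipMatrix (ofUnipCoords x) i j = x ⟨(i, j), hij⟩
  rw [coe_ofUnipCoords, unitriangularOfEntries_apply, if_neg (ne_of_lt hij), if_pos hij,
    extendCoords_of_lt x hij]

/-- `ofUnipCoords (unipCoords u) = u`. [folklore] -/
theorem ofUnipCoords_unipCoords (u : ↥(unipotentBorelAdelic n K)) :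
    ofUnipCoords (unipCoords u) = u := by
  obtain ⟨hut, hud⟩ := (mem_upperUnitriangular_iff _).1 ((mem_unipotentBorelAdelic_iff _).1 u.2)
  refine Subtype.ext (Subtype.ext (Units.ext ?_))
  change unipMatrix (ofUnipCoords (unipCoords u)) = unipMatrix u
  rw [coe_ofUnipCoords]
  exact unitriangularOfEntries_eq_of hut hud fun i j hij => by
    rw [extendCoords_of_lt _ hij]; rfl

/-- `unipCoords` is injective. [folklore] -/
theorem unipCoords_injective : Injective (unipCoords (n := n) (K := K)) := fun u v h => by
  rw [← ofUnipCoords_unipCoords u, ← ofUnipCoords_unipCoords v, h]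

/-- The coordinate map is continuous. [folklore] -/
theorem continuous_unipCoords : Continuous (unipCoords (n := n) (K := K)) := by
  refine continuous_pi fun p => ?_
  exact continuous_unipMatrix.matrix_elem p.1.1 p.1.2

/-- The inverse coordinate map is continuous. [folklore] -/
theorem continuous_ofUnipCoords : Continuous (ofUnipCoords (n := n) (K := K)) := by
  have hext : Continuous (extendCoords (n := n) (K := K)) := by
    refine continuous_pi fun i => continuous_pi fun j => ?_
    by_cases h : i < j
    · simp only [extendCoords, dif_pos h]; exact continuous_apply _
    · simp only [extendCoords, dif_neg h]; exact continuous_const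
  exact ((continuous_unitriangularGL.comp hext).subtype_mk _).subtype_mk _

variable (n K) in
/-- **`N(𝔸_K) ≃ₜ 𝔸_K^{n(n-1)/2}`**: the upper entries are global coordinates on the unipotent
radical (a homeomorphism). [folklore] -/
def unipCoordsHomeomorph : ↥(unipotentBorelAdelic n K) ≃ₜ (UpperIndex n → AdeleRing (𝓞 K) K) where
  toFun := unipCoords
  invFun := ofUnipCoords
  left_inv := ofUnipCoords_unipCoords
  right_inv := unipCoords_ofUnipCoords
  continuous_toFun := continuous_unipCoords
  continuous_invFun := continuous_ofUnipCoords

/-- The matrix underlying an element of `N(𝔸_K)` is upper unitriangular. [folklore] -/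
theorem unip_blockTriangular (u : ↥(unipotentBorelAdelic n K)) :
    (unipMatrix u).BlockTriangular id ∧ ∀ i, unipMatrix u i i = 1 :=
  (mem_upperUnitriangular_iff _).1 ((mem_unipotentBorelAdelic_iff _).1 u.2)

/-- The translation part of left multiplication by `u₀` in coordinates:
`F u₀ (i,j) x = u₀ i j + ∑_{i<k<j} u₀ i k · x (k, j)`. [folklore] -/
def unipShearFun (u₀ : ↥(unipotentBorelAdelic n K)) (p : UpperIndex n)
    (x : UpperIndex n → AdeleRing (𝓞 K) K) : AdeleRing (𝓞 K) K :=
  unipCoords u₀ p +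
    ∑ k ∈ Finset.univ.filter (fun k : Fin n => p.1.1 < k ∧ k < p.1.2),
      unipMatrix u₀ p.1.1 k * extendCoords x k p.1.2

/-- **Left multiplication in coordinates is a triangular shear**:
`coords (u₀ u) (i, j) = coords u (i, j) + F u₀ (i, j) (coords u)`
(`unitriangular_mul_apply_of_lt` of `UnipotentTateDomain`). [folklore] -/
theorem unipCoords_mul (u₀ u : ↥(unipotentBorelAdelic n K)) (p : UpperIndex n) :
    unipCoords (u₀ * u) p = unipCoords u p + unipShearFun u₀ p (unipCoords u) := by
  obtain ⟨⟨i, j⟩, hij⟩ := p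
  obtain ⟨h0t, h0d⟩ := unip_blockTriangular u₀
  obtain ⟨hut, hud⟩ := unip_blockTriangular u
  simp only [unipCoords, unipShearFun]
  rw [unipMatrix_mul, unitriangular_mul_apply_of_lt h0t h0d hut hud hij]
  dsimp only
  rw [add_assoc]
  congr 1
  congr 1
  refine Finset.sum_congr rfl fun k hk => ?_
  simp only [Finset.mem_filter, Finset.mem_univ, true_and] at hk
  rw [extendCoords_of_lt _ hk.2]
  rfl

/-- The shear function only depends on the coordinates of larger row index. [folklore] -/
theorem unipShearFun_dep (u₀ : ↥(unipotentBorelAdelic n K)) (p : UpperIndex n)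
    (x y : UpperIndex n → AdeleRing (𝓞 K) K)
    (h : ∀ q : UpperIndex n, (p.1.1 : ℕ) < (q.1.1 : ℕ) → x q = y q) :
    unipShearFun u₀ p x = unipShearFun u₀ p y := by
  simp only [unipShearFun]
  congr 1
  refine Finset.sum_congr rfl fun k hk => ?_
  simp only [Finset.mem_filter, Finset.mem_univ, true_and] at hk
  rw [extendCoords_of_lt _ hk.2, extendCoords_of_lt _ hk.2, h _ (by exact hk.1)]

end Coordinates

/-! ### The coordinate Haar measure on `N(𝔸_K)` -/

section HaarMeasure

variable (n : ℕ) (K : Type) [Field K] [NumberField K]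

attribute [local instance] adelicBorel borelSpace_adelic locallyCompactSpace_adelic
  secondCountableTopology_gl_adelic

variable [MeasurableSpace (AdeleRing (𝓞 K) K)] [BorelSpace (AdeleRing (𝓞 K) K)]
  (μA : Measure (AdeleRing (𝓞 K) K)) [μA.IsAddHaarMeasure]

/-- **The coordinate Haar measure on `N(𝔸_K)`**: the image of the product measure
`⊗_{i<j} μ_𝔸` of an additive Haar measure `μ_𝔸` of `𝔸_K` under the coordinate parametrisation
`𝔸_K^{(i<j)} → N(𝔸_K)`. [folklore] -/
def unipotentCoordHaar : Measure ↥(unipotentBorelAdelic n K) :=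
  Measure.map ofUnipCoords (Measure.pi fun _ : UpperIndex n => μA)

variable {n K}

/-- The shear functions are measurable. [folklore] -/
theorem measurable_unipShearFun (u₀ : ↥(unipotentBorelAdelic n K)) (p : UpperIndex n) :
    Measurable (unipShearFun u₀ p) := by
  haveI := secondCountableTopology_adeleRing K
  refine measurable_const.add (Finset.measurable_sum _ fun k _ => ?_)
  refine Measurable.const_mul ?_ _
  by_cases h : k < p.1.2
  · simp only [extendCoords, dif_pos h]; exact measurable_pi_apply _
  · simp only [extendCoords, dif_neg h]; exact measurable_const

/-- **Left translations of `N(𝔸_K)` preserve the coordinate measure** (the shear lemma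
`Shear.measurePreserving_shear` applied to `u ↦ u₀ u` in coordinates). [folklore] -/
theorem measurePreserving_coords_mul (u₀ : ↥(unipotentBorelAdelic n K)) :
    MeasurePreserving (fun x : UpperIndex n → AdeleRing (𝓞 K) K => unipCoords (u₀ * ofUnipCoords x))
      (Measure.pi fun _ : UpperIndex n => μA) (Measure.pi fun _ : UpperIndex n => μA) := by
  haveI := secondCountableTopology_adeleRing K
  haveI := locallyCompactSpace_adeleRing' K
  have heq : (fun x : UpperIndex n → AdeleRing (𝓞 K) K => unipCoords (u₀ * ofUnipCoords x)) =
      fun x p => x p + unipShearFun u₀ p x := by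
    funext x
    funext p
    rw [unipCoords_mul, unipCoords_ofUnipCoords]
  rw [heq]
  exact Shear.measurePreserving_shear μA (rank := fun p : UpperIndex n => (p.1.1 : ℕ))
    (f := unipShearFun u₀) (measurable_unipShearFun u₀) (unipShearFun_dep u₀)

/-- The coordinate measure is left invariant. [folklore] -/
theorem isMulLeftInvariant_unipotentCoordHaar :
    (unipotentCoordHaar n K μA).IsMulLeftInvariant := by
  haveI := secondCountableTopology_adeleRing K
  haveI := locallyCompactSpace_adeleRing' K
  refine ⟨fun u₀ => ?_⟩
  have hm : Measurable (ofUnipCoords (n := n) (K := K)) := continuous_ofUnipCoords.measurable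
  rw [unipotentCoordHaar, map_map (measurable_const_mul u₀) hm]
  have hcomp : ((u₀ * ·) ∘ ofUnipCoords) =
      ofUnipCoords ∘ fun x : UpperIndex n → AdeleRing (𝓞 K) K => unipCoords (u₀ * ofUnipCoords x) := by
    funext x
    simp only [comp_apply]
    rw [ofUnipCoords_unipCoords]
  rw [hcomp, ← map_map hm (measurePreserving_coords_mul μA u₀).measurable,
    (measurePreserving_coords_mul μA u₀).map_eq]

/-- **The coordinate measure is a Haar measure on `N(𝔸_K)`** (left invariant by the shear
lemma; finite on compact sets and positive on open sets because the coordinates form a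
homeomorphism and `⊗ μ_𝔸` is a Haar measure of `𝔸_K^{(i<j)}`). Hence every Haar measure of
`N_n(𝔸_K)` is `∏_{i<j} du_{ij}` up to a constant (Bourbaki, *Intégration* VII §3 no. 3).
[folklore] -/
instance isHaarMeasure_unipotentCoordHaar : (unipotentCoordHaar n K μA).IsHaarMeasure := by
  haveI := secondCountableTopology_adeleRing K
  haveI := locallyCompactSpace_adeleRing' K
  haveI := t2Space_adeleRing K
  haveI : T2Space (AdeleRing (𝓞 K) K) := t2Space_adeleRing K
  haveI : T2Space (AdelicGroupData.gl n K).Adelic :=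
    inferInstanceAs (T2Space (GL (Fin n) (AdeleRing (𝓞 K) K)))
  haveI := isMulLeftInvariant_unipotentCoordHaar (n := n) μA
  have hm : Measurable (ofUnipCoords (n := n) (K := K)) := continuous_ofUnipCoords.measurable
  set e := unipCoordsHomeomorph n K with he
  refine { lt_top_of_isCompact := fun C hC => ?_, open_pos := fun U hU hne => ?_ }
  · rw [unipotentCoordHaar, map_apply hm hC.measurableSet]
    have : ofUnipCoords ⁻¹' C = e '' C := by
      ext x
      simp only [mem_preimage, mem_image]
      constructor
      · intro hx; exact ⟨ofUnipCoords x, hx, unipCoords_ofUnipCoords x⟩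
      · rintro ⟨u, hu, rfl⟩
        change ofUnipCoords (unipCoords u) ∈ C
        rwa [ofUnipCoords_unipCoords]
    rw [this]
    exact (hC.image e.continuous).measure_lt_top
  · rw [unipotentCoordHaar, map_apply hm hU.measurableSet]
    refine (hU.preimage continuous_ofUnipCoords).measure_ne_zero _ ?_
    obtain ⟨u, hu⟩ := hne
    exact ⟨unipCoords u, show ofUnipCoords (unipCoords u) ∈ U by rwa [ofUnipCoords_unipCoords]⟩

/-- **The coordinate Haar measure of a coordinate box** `{u | u i j ∈ D (i, j) ∀ i < j}` is
`∏_{i<j} μ_𝔸 (D (i, j))`. [folklore] -/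
theorem unipotentCoordHaar_box (D : UpperIndex n → Set (AdeleRing (𝓞 K) K)) :
    unipotentCoordHaar n K μA {u | ∀ p, unipCoords u p ∈ D p} = ∏ p, μA (D p) := by
  haveI := secondCountableTopology_adeleRing K
  haveI := locallyCompactSpace_adeleRing' K
  have hm : Measurable (ofUnipCoords (n := n) (K := K)) := continuous_ofUnipCoords.measurable
  have hpre : ofUnipCoords ⁻¹' {u : ↥(unipotentBorelAdelic n K) | ∀ p, unipCoords u p ∈ D p} =
      Set.pi univ D := by
    ext x
    simp only [mem_preimage, mem_setOf_eq, mem_univ_pi, unipCoords_ofUnipCoords]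
  rw [unipotentCoordHaar, ← Measure.pi_pi, ← hpre]
  -- `map f μ s ≥ μ (f ⁻¹ s)` with equality for measurable `s`; here we use the measurable hull
  refine le_antisymm ?_ (le_map_apply hm.aemeasurable _)
  rw [hpre]
  calc Measure.map ofUnipCoords (Measure.pi fun _ : UpperIndex n => μA)
        {u | ∀ p, unipCoords u p ∈ D p}
      ≤ Measure.map ofUnipCoords (Measure.pi fun _ : UpperIndex n => μA)
          {u | ∀ p, unipCoords u p ∈ toMeasurable μA (D p)} := by
        refine measure_mono fun u hu p => subset_toMeasurable _ _ (hu p)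
    _ = Measure.pi (fun _ : UpperIndex n => μA) (Set.pi univ fun p => toMeasurable μA (D p)) := by
        rw [map_apply hm]
        · congr 1
          ext x
          simp only [mem_preimage, mem_setOf_eq, mem_univ_pi, unipCoords_ofUnipCoords]
        · have : {u : ↥(unipotentBorelAdelic n K) | ∀ p, unipCoords u p ∈ toMeasurable μA (D p)} =
              ⋂ p : UpperIndex n, (fun u => unipCoords u p) ⁻¹' toMeasurable μA (D p) := by
            ext u; simp only [mem_setOf_eq, mem_iInter, mem_preimage]
          rw [this]
          refine MeasurableSet.iInter fun p => ?_
          exact (measurableSet_toMeasurable _ _).preimage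
            ((measurable_pi_apply p).comp continuous_unipCoords.measurable)
    _ = ∏ p, μA (toMeasurable μA (D p)) := Measure.pi_pi _ _
    _ = ∏ p, μA (D p) := by simp only [measure_toMeasurable]
    _ = Measure.pi (fun _ : UpperIndex n => μA) (Set.pi univ D) := (Measure.pi_pi _ _).symm

end HaarMeasure

end Literature.NumberTheory.Automorphic
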